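import Mathlib.Analysis.Calculus.Darboux
import Summits.KontsevichZagierPeriods.KontsevichZagierPeriods.Theorems.PlanarAreas.Negative.GreenBandsLoadBearing
import Summits.KontsevichZagierPeriods.KontsevichZagierPeriods.Theorems.PlanarAreas.Negative.Strengthenings
import Literature.NumberTheory.Transcendental.KZLogCalculus

/-!
# `PlanarAreas` (stmt-KontsevichZagierPeriods-4990), line `green-native-bands`: the open-strip guard
# of the worker sub-stub `stub_bandNewtonLeibniz_subband` is load-bearing AT THE LEVEL OF THE MOVE

Refuter unit `drefute-stmt-KontsevichZagierPeriods-4990-g3` (companion of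
`GreenBandsSubbandLoadBearing.lean`, which certifies three value-level guards). The sub-stub
`stub_bandNewtonLeibniz_subband` (registered 2026-08-16T03:57Z, skeleton sha 495091be93cf) concludes
with a SINGLE `KZ.newtonLeibnizRel` instance over the base cell `C`. Delete its hypothesis
`C ⊆ {x | a₀ < x 0 < a₁}` and the statement becomes false — but only syntactically, not numerically:

`not_subbandWithoutStrip`: take the unit square with `F = 0`, `Z = ∅` and the integrand
`stripF = 𝟙{x ≤ 0 ∧ y + y ≥ 1}` (zero off the null end-point fibre `x = 0`, so every hypothesis of the
stub holds and all VALUES agree), the base `C = [0,1) ⊂ ℝ¹` (touching the end point), `lo = 0`,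
`hi = 1`. The asserted Newton–Leibniz instance must relate `Bd` and `b` themselves
(`of_sub_of_eq_of_sub_of`, `Negative/Strengthenings.lean`), so over the base point `x = 0` its fibre
primitive `g` would satisfy `HasDerivAt g (𝟙{t + t ≥ 1}) t` at EVERY `t ∈ (0,1)` — a derivative without
the intermediate-value property, contradicting Darboux (`exists_hasDerivWithinAt_eq_of_gt_of_lt`).

Moral for the engine's assembly: the sub-band move reads the primitive on every fibre over `C`, null
base sets included, so the cells fed to it must avoid the end points `a₀, a₁` (where the engine's
derivative hypothesis is silent) — which the cells carrying `B`-bands of the open band automatically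
do; at the level of `KZ.relations` the end-point fibres are removable by rule 1a.
-/

noncomputable section

open Set MeasureTheory MvPolynomial Filter Topology
open Literature.NumberTheory.Transcendental Literature.ModelTheory.ExponentialFields

namespace Summit.KontsevichZagierPeriods.PlanarAreas.Negative.GreenBands

/-! ## The open-strip guard `C ⊆ {a₀ < x < a₁}` is load-bearing (at the level of the move) -/

/-- `ℝ¹ × ℝ` coordinates: `Fin.snoc x t = ![x 0, t]`. -/
theorem snoc_fin_one (x : Fin 1 → ℝ) (t : ℝ) : (Fin.snoc x t : Fin 2 → ℝ) = ![x 0, t] := by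
  funext i
  refine Fin.lastCases ?_ (fun j => ?_) i
  · rw [Fin.snoc_last]; rfl
  · rw [Fin.snoc_castSucc, Fin.fin_one_eq_zero j]; rfl

/-- The witness integrand `𝟙{x ≤ 0 ∧ y + y ≥ 1}`: zero off the end-point fibre `x = 0` of the square,
and on that fibre a jump function of `y` (no intermediate-value property). -/
def stripF : (Fin 2 → ℝ) → ℝ := fun p => if p 0 ≤ 0 ∧ 1 ≤ p 1 + p 1 then 1 else 0

/-- `stripF` is `ℚ`-semialgebraic on the closed square (two constant pieces). -/
theorem isSemialgebraicFunOn_stripF : IsSemialgebraicFunOn ℚ closedSquareSet stripF := by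
  have hA1 : IsSemialgebraic ℚ {x : Fin 2 → ℝ | x 0 ≤ 0} := by
    simpa using isSemialgebraic_setOf_eval_le (k := ℚ) (R := ℝ) (ι := Fin 2) (X 0) (C 0)
  have hA2 : IsSemialgebraic ℚ {x : Fin 2 → ℝ | 1 ≤ x 1 + x 1} := by
    have h := isSemialgebraic_setOf_eval_le (k := ℚ) (R := ℝ) (ι := Fin 2) (C 1) (X 1 + X 1)
    simp only [map_add, MvPolynomial.aeval_X, map_one] at h
    exact h
  have hB1 : IsSemialgebraic ℚ {x : Fin 2 → ℝ | 0 < x 0} := by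
    simpa using isSemialgebraic_setOf_eval_lt (k := ℚ) (R := ℝ) (ι := Fin 2) (C 0) (X 0)
  have hB2 : IsSemialgebraic ℚ {x : Fin 2 → ℝ | x 1 + x 1 < 1} := by
    have h := isSemialgebraic_setOf_eval_lt (k := ℚ) (R := ℝ) (ι := Fin 2) (X 1 + X 1) (C 1)
    simp only [map_add, MvPolynomial.aeval_X, map_one] at h
    exact h
  have h1 : IsSemialgebraicFunOn ℚ
      (closedSquareSet ∩ ({x : Fin 2 → ℝ | x 0 ≤ 0} ∩ {x : Fin 2 → ℝ | 1 ≤ x 1 + x 1}))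
      (fun _ => (1 : ℝ)) := by
    simpa using isSemialgebraicFunOn_natCast (isSemialgebraic_closedSquareSet.inter (hA1.inter hA2)) 1
  have h0 : IsSemialgebraicFunOn ℚ
      (closedSquareSet ∩ ({x : Fin 2 → ℝ | 0 < x 0} ∪ {x : Fin 2 → ℝ | x 1 + x 1 < 1}))
      (fun _ => (0 : ℝ)) := by
    simpa using isSemialgebraicFunOn_natCast (isSemialgebraic_closedSquareSet.inter (hB1.union hB2)) 0
  have hU : closedSquareSet ∩ ({x : Fin 2 → ℝ | x 0 ≤ 0} ∩ {x : Fin 2 → ℝ | 1 ≤ x 1 + x 1}) ∪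
      closedSquareSet ∩ ({x : Fin 2 → ℝ | 0 < x 0} ∪ {x : Fin 2 → ℝ | x 1 + x 1 < 1}) =
      closedSquareSet := by
    rw [← inter_union_distrib_left]
    refine inter_eq_left.mpr fun x _ => ?_
    simp only [mem_union, mem_inter_iff, mem_setOf_eq]
    rcases le_or_gt (x 0) 0 with h | h
    · rcases le_or_gt 1 (x 1 + x 1) with h' | h'
      · exact Or.inl ⟨h, h'⟩
      · exact Or.inr (Or.inr h')
    · exact Or.inr (Or.inl h)
  rw [← hU]
  refine h1.union h0 (fun x hx => ?_) (fun x hx => ?_)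
  · exact if_pos hx.2
  · have : ¬ (x 0 ≤ 0 ∧ 1 ≤ x 1 + x 1) := by
      rcases hx.2 with h | h
      · exact fun hc => (not_lt.mpr hc.1) h
      · exact fun hc => (not_lt.mpr hc.2) h
    exact if_neg this

/-- `stripF` is measurable. -/
theorem measurable_stripF : Measurable stripF := by
  refine Measurable.ite ?_ measurable_const measurable_const
  exact (measurableSet_le (measurable_pi_apply 0) measurable_const).inter
    (measurableSet_le measurable_const ((measurable_pi_apply 1).add (measurable_pi_apply 1)))

/-- `stripF` is integrable on the closed square (bounded by `1` on a set of area `1`). -/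
theorem integrableOn_stripF : IntegrableOn stripF closedSquareSet volume := by
  refine Measure.integrableOn_of_bounded (M := 1) ?_ measurable_stripF.aestronglyMeasurable ?_
  · rw [volume_closedSquareSet]; exact ENNReal.one_ne_top
  · refine Eventually.of_forall fun p => ?_
    unfold stripF
    split_ifs <;> simp

/-- `[[0,1]², stripF]`: the square with the witness integrand (value `0`). -/
def stripRep : KZ.IntegralRep 2 where
  domain := closedSquareSet
  integrand := stripF
  isSemialgebraic_domain := isSemialgebraic_closedSquareSet
  isSemialgebraicFunOn_integrand := isSemialgebraicFunOn_stripF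
  integrableOn := integrableOn_stripF

/-- The base `[0,1) ⊂ ℝ¹`, which TOUCHES the end point `x = 0`. -/
def icoBase : Set (Fin 1 → ℝ) := {x : Fin 1 → ℝ | x 0 ∈ Set.Ico (0 : ℝ) 1}

/-- `icoBase` is `ℚ`-semialgebraic. -/
theorem isSemialgebraic_icoBase : IsSemialgebraic ℚ icoBase := by
  have h1 := isSemialgebraic_setOf_eval_le (k := ℚ) (R := ℝ) (ι := Fin 1) (C 0) (X 0)
  have h2 := isSemialgebraic_setOf_eval_lt (k := ℚ) (R := ℝ) (ι := Fin 1) (X 0) (C 1)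
  have hEq : icoBase = {x : Fin 1 → ℝ | aeval x (C 0 : MvPolynomial (Fin 1) ℚ) ≤ aeval x (X 0 : MvPolynomial (Fin 1) ℚ)} ∩
      {x : Fin 1 → ℝ | aeval x (X 0 : MvPolynomial (Fin 1) ℚ) < aeval x (C 1 : MvPolynomial (Fin 1) ℚ)} := by
    ext x
    simp [icoBase]
  rw [hEq]
  exact h1.inter h2

/-- `stub_bandNewtonLeibniz_subband` with the hypothesis `C ⊆ {x | x 0 ∈ Set.Ioo a₀ a₁}` DELETED
(everything else verbatim). -/
def SubbandWithoutStrip : Prop := ∀ (a₀ a₁ : ℚ) (α β : ℝ → ℝ) (F : (Fin 2 → ℝ) → ℝ)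
    (Z : Set (Fin 2 → ℝ)) (r : KZ.IntegralRep 2),
    r.domain = {p : Fin 2 → ℝ | p 0 ∈ Set.Icc (a₀ : ℝ) a₁ ∧ α (p 0) ≤ p 1 ∧ p 1 ≤ β (p 0)} →
    IsSemialgebraicFunOn ℚ r.domain F → (∃ M : ℝ, ∀ p ∈ r.domain, |F p| ≤ M) →
    (∀ t ∈ Set.Ioo (a₀ : ℝ) a₁, ContinuousOn (fun s : ℝ => F ![t, s]) (Set.Icc (α t) (β t))) →
    (∀ p ∈ r.domain, p 0 ∈ Set.Ioo (a₀ : ℝ) a₁ → α (p 0) < p 1 → p 1 < β (p 0) → p ∉ Z →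
      HasDerivAt (fun s : ℝ => F ![p 0, s]) (r.integrand p) (p 1)) →
    ∀ {C : Set (Fin 1 → ℝ)}, IsSemialgebraic ℚ C →
    ∀ {lo hi : (Fin 1 → ℝ) → ℝ}, IsSemialgebraicFunOn ℚ C lo → IsSemialgebraicFunOn ℚ C hi →
    (∀ x ∈ C, lo x < hi x) →
    (∀ x ∈ C, ∀ t ∈ Set.Ioo (lo x) (hi x), (α (x 0) < t ∧ t < β (x 0)) ∧
      (Fin.snoc x t : Fin 2 → ℝ) ∉ Z) →
    ∃ (Bd : KZ.IntegralRep 2) (b : KZ.IntegralRep 1), Bd.domain = KZlog.band C lo hi ∧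
      Bd.domain ⊆ r.domain ∧ Bd.integrand = r.integrand ∧ b.domain = C ∧
      (b.integrand = fun x => F (Fin.snoc x (hi x)) - F (Fin.snoc x (lo x))) ∧
      KZ.of Bd - KZ.of b ∈ KZ.newtonLeibnizRel

/-- **The open-strip guard is load-bearing in `stub_bandNewtonLeibniz_subband`, at the level of the
single move.** Witness: the square, `F = 0`, `Z = ∅`, integrand `stripF` (zero off the null fibre
`x = 0`), base `C = [0,1)`, `lo = 0`, `hi = 1`. The asserted Newton–Leibniz instance must relate `Bd`
and `b` themselves (`of_sub_of_eq_of_sub_of`), so over `x = 0` its primitive would have the jump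
`𝟙{2t ≥ 1}` as an honest derivative on `(0,1)` — impossible by Darboux. -/
theorem not_subbandWithoutStrip : ¬ SubbandWithoutStrip := by
  intro h
  have hF : IsSemialgebraicFunOn ℚ stripRep.domain (fun _ : Fin 2 → ℝ => (0 : ℝ)) := by
    show IsSemialgebraicFunOn ℚ closedSquareSet (fun _ : Fin 2 → ℝ => (0 : ℝ))
    simpa using isSemialgebraicFunOn_natCast isSemialgebraic_closedSquareSet 0
  have hbd : ∃ M : ℝ, ∀ p ∈ stripRep.domain, |(fun _ : Fin 2 → ℝ => (0 : ℝ)) p| ≤ M :=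
    ⟨0, fun p _ => by simp⟩
  have hder : ∀ p ∈ stripRep.domain, p 0 ∈ Set.Ioo (((0 : ℚ)) : ℝ) ((1 : ℚ) : ℝ) →
      (fun _ : ℝ => (0 : ℝ)) (p 0) < p 1 → p 1 < (fun _ : ℝ => (1 : ℝ)) (p 0) →
      p ∉ (∅ : Set (Fin 2 → ℝ)) →
      HasDerivAt (fun s : ℝ => (fun _ : Fin 2 → ℝ => (0 : ℝ)) ![p 0, s]) (stripRep.integrand p) (p 1) := by
    intro p _ hp0 _ _ _
    have hp : (0 : ℝ) < p 0 := by simpa using hp0.1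
    have h0 : stripRep.integrand p = 0 := if_neg fun hc => (not_lt.mpr hc.1) hp
    rw [h0]
    simpa using hasDerivAt_const (p 1) (0 : ℝ)
  have hlo : IsSemialgebraicFunOn ℚ icoBase (fun _ : Fin 1 → ℝ => (0 : ℝ)) := by
    simpa using isSemialgebraicFunOn_natCast isSemialgebraic_icoBase 0
  have hhi : IsSemialgebraicFunOn ℚ icoBase (fun _ : Fin 1 → ℝ => (1 : ℝ)) := by
    simpa using isSemialgebraicFunOn_natCast isSemialgebraic_icoBase 1
  have hguard : ∀ x ∈ icoBase, ∀ t ∈ Set.Ioo ((fun _ : Fin 1 → ℝ => (0 : ℝ)) x)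
      ((fun _ : Fin 1 → ℝ => (1 : ℝ)) x),
      ((fun _ : ℝ => (0 : ℝ)) (x 0) < t ∧ t < (fun _ : ℝ => (1 : ℝ)) (x 0)) ∧
        (Fin.snoc x t : Fin 2 → ℝ) ∉ (∅ : Set (Fin 2 → ℝ)) :=
    fun x _ t ht => ⟨ht, notMem_empty _⟩
  obtain ⟨Bd, b, hBd, -, hBi, hbdom, -, hrel⟩ := h 0 1 (fun _ => 0) (fun _ => 1) (fun _ => 0) ∅
    stripRep closedSquareSet_eq_band hF hbd (fun t _ => continuousOn_const) hder (C := icoBase)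
    isSemialgebraic_icoBase (lo := fun _ => 0) (hi := fun _ => 1) hlo hhi (fun x _ => zero_lt_one)
    hguard
  -- unpack the single move: it relates `Bd` and `b` themselves
  obtain ⟨n, r₂, r₁, a, b', F', -, -, -, -, hdom₂, -, hder₂, -, heq⟩ := hrel
  have hne : (⟨2, Bd⟩ : Σ k, KZ.IntegralRep k) ≠ ⟨1, b⟩ := fun h => by
    have h2 : (2 : ℕ) = 1 := congrArg Sigma.fst h
    omega
  obtain ⟨h1, h2⟩ := of_sub_of_eq_of_sub_of (X := Σ k, KZ.IntegralRep k) heq hne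
  obtain ⟨hn, hb⟩ := Sigma.mk.inj_iff.mp h2
  subst hn
  obtain rfl : b = r₁ := eq_of_heq hb
  obtain rfl : Bd = r₂ := eq_of_heq (Sigma.mk.inj_iff.mp h1).2
  -- the base point `x₀ = 0 ∈ [0,1)` and its fibre `[a x₀, b' x₀] ⊇ [0, 1]`
  set x₀ : Fin 1 → ℝ := fun _ => 0 with hx₀
  have hx₀C : x₀ ∈ icoBase := by simp [icoBase, hx₀]
  have hx₀b : x₀ ∈ b.domain := by rw [hbdom]; exact hx₀C
  have hfib : ∀ t ∈ Set.Icc (0 : ℝ) 1, a x₀ ≤ t ∧ t ≤ b' x₀ := by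
    intro t ht
    have hz : (Fin.snoc x₀ t : Fin 2 → ℝ) ∈ Bd.domain := by
      rw [hBd, KZlog.snoc_mem_band]
      exact ⟨hx₀C, ht⟩
    rw [hdom₂] at hz
    obtain ⟨-, hz1, hz2⟩ := hz
    simp only [Fin.init_snoc, Fin.snoc_last] at hz1 hz2
    exact ⟨hz1, hz2⟩
  have ha : a x₀ ≤ 0 := (hfib 0 ⟨le_rfl, zero_le_one⟩).1
  have hb1 : 1 ≤ b' x₀ := (hfib 1 ⟨zero_le_one, le_rfl⟩).2
  -- the would-be derivative on the fibre over `x₀` is the jump `𝟙{2t ≥ 1}`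
  have hval : ∀ t : ℝ, stripF (Fin.snoc x₀ t) = if 1 ≤ t + t then 1 else 0 := by
    intro t
    rw [snoc_fin_one]
    simp [stripF, hx₀]
  have hderiv : ∀ t ∈ Set.Icc (1 / 4 : ℝ) (3 / 4),
      HasDerivWithinAt (fun s : ℝ => F' (Fin.snoc x₀ s)) ((fun t : ℝ => if 1 ≤ t + t then (1 : ℝ) else 0) t)
        (Set.Icc (1 / 4 : ℝ) (3 / 4)) t := by
    intro t ht
    have ht' : t ∈ Set.Ioo (a x₀) (b' x₀) := ⟨by linarith [ht.1], by linarith [ht.2]⟩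
    have hd := hder₂ x₀ hx₀b t ht'
    rw [hBi] at hd
    have hd' : HasDerivAt (fun s : ℝ => F' (Fin.snoc x₀ s)) (stripF (Fin.snoc x₀ t)) t := hd
    rw [hval t] at hd'
    exact hd'.hasDerivWithinAt
  obtain ⟨c, -, hc⟩ := exists_hasDerivWithinAt_eq_of_gt_of_lt (m := 1 / 2) (by norm_num) hderiv
    (by norm_num) (by norm_num)
  -- `hc : (if 1 ≤ c + c then 1 else 0) = 1 / 2`
  have hc' : (if 1 ≤ c + c then (1 : ℝ) else 0) = 1 / 2 := hc
  split_ifs at hc' <;> norm_num at hc'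

end Summit.KontsevichZagierPeriods.PlanarAreas.Negative.GreenBands

end
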